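import Literature.ModelTheory.ExponentialFields.DefinableSmoothLocus
import Literature.ModelTheory.ExponentialFields.PilaWilkieLastVariable
import Literature.ModelTheory.ExponentialFields.PilaWilkieWordTools
import Mathlib.Analysis.Calculus.ContDiff.Bounds
import HarnessLib

/-!
# All partials after the change of the last variable (Bhardwaj–van den Dries 2022, Cor. 6.4), uniformly, vector-valued

Topic `Literature/ModelTheory/ExponentialFields`; proof file in the cone of the named fact
`PilaWilkie2006_thm_1_8`.  Bhardwaj–van den Dries 2022, Cor. 6.4: iterating Lemma 6.2 on
the families of partials `f_φ^{(α)}` one obtains, for every `l ≤ k`, a `k`-parametrization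
`Φ_l` of a cofinite subset of `(0,1)` and `V_l ⋐ U` with `I_φ(V_l) ⊆ U`, `f_φ` of class `C^k`
on `V_l` and `f_φ^{(α)}` strongly bounded on `V_l` for `|α| ≤ k`, `α_{m+1} ≤ l`.  Here over
`ℝ`, uniformly in parameters `v`, for a tuple of functions, in the word formalism
(`pderivWord`; the count of the letter `last` plays the role of `α_{m+1}`):

* `wordPartials_eq_pderivWord` — the canonical definable word partials agree with the
  classical ones on smooth open fibres;
* `perm_replicate_append_horizontal`, `abs_iteratedDerivWithin_comp_le`,
  `pderiv_const_mul`, `pderivWord_const_mul`, `abs_iteratedDerivWithin_id_le` — tools;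
* **`lastVariable_Ck_step`** — the induction step `l → l+1` (Lemma 6.2 at order `k+1`
  applied to `B_l⁻¹ ∂^w f_θ`, `|w| ≤ k−1`; new charts `θ ∘ ψ`; bounds by
  `iteratedDeriv_comp_bounds`);
* **`lastVariable_Ck`** — the corollary for all `l ≤ k` (base: `Φ_0 = {id}`, `V_0 =` the `C^k`
  locus from `exists_contDiffOn_locus_family_of_field`).

Nothing here is a named fact; no definitions.

## References

* N. Bhardwaj, L. van den Dries, *On the Pila–Wilkie theorem*, Expo. Math. 40 (2022), §6,
  Cor. 6.3, Cor. 6.4 and their proofs. [BhardwajVanDenDries2022]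
-/

noncomputable section

open Set FirstOrder FirstOrder.Language Filter Topology Function

namespace Literature.ModelTheory.ExponentialFields

/-! ### Tools for Bhardwaj–van den Dries 2022, Cor. 6.4 -/

section C64Tools

variable {L : FirstOrder.Language.{0, 0}} [L.Structure ℝ]

/-- **Canonical word partials are the classical ones on smooth open fibres**: if the
definable iterated partials `D_w` of `H : ℝ^{p+N} → ℝ` satisfy the defining property
(`D_{i::w}(u) = ∂D_w/∂u_i (u)` wherever this exists) and `y ↦ H(v, y)` is `C^q` on an open
`O`, then `D_{w↑}(v, y) = ∂^w (H(v,·))(y)` on `O` for `|w| ≤ q` (`w↑` = `w` read in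
`ℝ^{p+N}` through `natAdd p`). [folklore] -/
theorem wordPartials_eq_pderivWord {p N : ℕ} {H : (Fin (p + N) → ℝ) → ℝ}
    {D : List (Fin (p + N)) → (Fin (p + N) → ℝ) → ℝ} (hD0 : D [] = H)
    (hDspec : ∀ (i : Fin (p + N)) (w : List (Fin (p + N))) (x : Fin (p + N) → ℝ) (d : ℝ),
      HasPartialDerivAt (D w) i d x → D (i :: w) x = d)
    {O : Set (Fin N → ℝ)} (hO : IsOpen O) (v : Fin p → ℝ) {q : ℕ}
    (hH : ContDiffOn ℝ (q : WithTop ℕ∞) (fun y => H (Fin.append v y)) O) :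
    ∀ w : List (Fin N), w.length ≤ q →
      EqOn (fun y => D (w.map (Fin.natAdd p)) (Fin.append v y)) (pderivWord w (fun y => H (Fin.append v y))) O
  | [], _ => fun y _ => by simp [hD0]
  | i :: w, hw => by
    intro y hy
    rw [List.length_cons] at hw
    have ih := wordPartials_eq_pderivWord hD0 hDspec hO v hH w (by omega)
    rw [List.map_cons, pderivWord_cons]
    simp only
    -- `∂^w H(v,·)` is `C¹` on `O`
    have hW : ContDiffOn ℝ 1 (pderivWord w (fun y => H (Fin.append v y))) O := by
      have h1 : ContDiffOn ℝ (((1 : ℕ) + w.length : ℕ) : WithTop ℕ∞) (fun y => H (Fin.append v y)) O :=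
        hH.of_le (by exact_mod_cast (show 1 + w.length ≤ q by omega))
      exact_mod_cast ContDiffOn.pderivWord hO w h1
    have hWd : DifferentiableAt ℝ (pderivWord w (fun y => H (Fin.append v y))) y :=
      (hW.differentiableOn one_ne_zero y hy).differentiableAt (hO.mem_nhds hy)
    -- the canonical partial at `(v, y)` in direction `natAdd p i`
    apply hDspec
    rw [← hasPartialDerivAt_append_iff]
    -- `HasPartialDerivAt (fun z => D w↑ (v, z)) i (∂_i ∂^w H(v,·) (y)) y`, via the classical partial of `∂^w H(v,·)`
    rw [hasPartialDerivAt_iff, hasFieldDerivAt_iff_hasDerivAt]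
    have hsec := hasDerivAt_section_of_differentiableAt hWd i
    -- the sections of `z ↦ D w↑ (v,z)` and of `∂^w H(v,·)` agree near `y i`
    refine hsec.congr_of_eventuallyEq ?_
    have hpre : IsOpen {s : ℝ | Function.update y i s ∈ O} := hO.preimage (by fun_prop)
    have hmem : y i ∈ {s : ℝ | Function.update y i s ∈ O} := by simp [hy]
    filter_upwards [hpre.mem_nhds hmem] with s hs
    exact ih hs

/-- Any word over `Fin (m+1)` is a permutation of its `last` letters followed by its
horizontal letters. [folklore] -/
theorem perm_replicate_append_horizontal {m : ℕ} (w : List (Fin (m + 1))) :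
    ∃ (j : ℕ) (wh : List (Fin m)), j = w.count (Fin.last m) ∧ j + wh.length = w.length ∧
      w.Perm (List.replicate j (Fin.last m) ++ wh.map Fin.castSucc) := by
  induction w with
  | nil => exact ⟨0, [], by simp, by simp, by simp⟩
  | cons a w ih =>
    obtain ⟨j, wh, hj, hlen, hperm⟩ := ih
    by_cases ha : a = Fin.last m
    · subst ha
      refine ⟨j + 1, wh, by simp [hj], by simp; omega, ?_⟩
      rw [List.replicate_succ, List.cons_append]
      exact hperm.cons _
    · set a' : Fin m := a.castPred ha with ha'
      have haa : Fin.castSucc a' = a := Fin.castSucc_castPred a ha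
      refine ⟨j, a' :: wh, by simp [hj, ha], by simp; omega, ?_⟩
      rw [List.map_cons, haa]
      exact (hperm.cons a).trans List.perm_middle.symm

/-- **Derivative bounds for a composition of unary charts** (Bhardwaj–van den Dries 2022,
Lemma 4.5 shape): `|(θ ∘ ψ)^{(i)}| ≤ i!·C` on an open `J` if `|θ^{(q)}| ≤ C` (`q ≤ i`) on an
open `J' ⊇ ψ(J)` and `|ψ^{(q)}| ≤ 1` (`1 ≤ q ≤ i`) on `J`. [cite: BhardwajVanDenDries2022, Lemma 4.5] -/
theorem abs_iteratedDerivWithin_comp_le {J J' : Set ℝ} (hJ : IsOpen J) (hJ' : IsOpen J') {θ ψ : ℝ → ℝ}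
    {n : ℕ} {C : ℝ} (hθ : ContDiffOn ℝ n θ J') (hψ : ContDiffOn ℝ n ψ J) (hmaps : MapsTo ψ J J')
    (hθb : ∀ q ≤ n, ∀ y ∈ J', |iteratedDerivWithin q θ J' y| ≤ C)
    (hψb : ∀ q, 1 ≤ q → q ≤ n → ∀ t ∈ J, |iteratedDerivWithin q ψ J t| ≤ 1) {t : ℝ} (ht : t ∈ J) :
    |iteratedDerivWithin n (fun t => θ (ψ t)) J t| ≤ n.factorial * C := by
  have h := norm_iteratedFDerivWithin_comp_le (n := n) (N := (n : WithTop ℕ∞)) hθ hψ le_rfl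
    hJ'.uniqueDiffOn hJ.uniqueDiffOn hmaps ht (C := C) (D := 1) ?_ ?_
  · simpa [norm_iteratedFDerivWithin_eq_norm_iteratedDerivWithin, Real.norm_eq_abs, Function.comp_def] using h
  · intro i hi
    rw [norm_iteratedFDerivWithin_eq_norm_iteratedDerivWithin, Real.norm_eq_abs]
    exact hθb i hi _ (hmaps ht)
  · intro i hi1 hi
    rw [norm_iteratedFDerivWithin_eq_norm_iteratedDerivWithin, Real.norm_eq_abs, one_pow]
    exact hψb i hi1 hi t ht

end C64Tools

/-! ### Bhardwaj–van den Dries 2022, Cor. 6.4: the induction step, uniformly -/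

section C64Step

open Classical

variable {L : FirstOrder.Language.{0, 0}} [L.Structure ℝ]

/-- Local notation: the open unit cube `(0,1)^ℓ`. -/
local notation "𝕀^" ℓ:max => (Set.pi Set.univ fun _ : Fin ℓ => Set.Ioo (0 : ℝ) 1)

/-- `∂_i (c · K) = c · ∂_i K`. [folklore] -/
theorem pderiv_const_mul {N : ℕ} (i : Fin N) (c : ℝ) (K : (Fin N → ℝ) → ℝ) (x : Fin N → ℝ) :
    pderiv i (fun y => c * K y) x = c * pderiv i K x := by
  simp only [pderiv]
  rw [show (fun y => c * K y) = c • K from rfl, fderiv_const_smul_field, Pi.smul_apply,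
    FunLike.coe_smul, Pi.smul_apply, smul_eq_mul]

/-- Word version: `∂^w (c · K) = c · ∂^w K`. [folklore] -/
theorem pderivWord_const_mul {N : ℕ} (c : ℝ) (K : (Fin N → ℝ) → ℝ) :
    ∀ w : List (Fin N), pderivWord w (fun y => c * K y) = fun x => c * pderivWord w K x
  | [] => rfl
  | i :: w => by
    rw [pderivWord_cons, pderivWord_cons, pderivWord_const_mul c K w]
    funext x
    exact pderiv_const_mul i c _ x

/-- **Bhardwaj–van den Dries 2022, Cor. 6.4, induction step `l → l + 1`, uniformly in
parameters over `ℝ` and for a tuple of functions**: given the data `(Φ_l, V_l)` of the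
corollary (finitely many definable families of strictly monotone `C^k` unary charts
`θ : (0,1) → (0,1)` with bounded derivatives covering `(0,1)` up to finitely many points; a
definable `V_l` with open fibres, `V_l ⋐ U`, `I_θ(V_l) ⊆ U`, `f_θ = f ∘ I_θ` of class `C^k` on
`V_l` with `|∂^w f_θ| ≤ B_l` for all words `w`, `|w| ≤ k`, with at most `l` letters `x_{m+1}`),
Lemma 6.2 (`lastVariable_step`, order `k + 1`) applied to the functions
`B_l⁻¹ ∂^{w} f_θ` (`|w| ≤ k − 1`, at most `l` letters `x_{m+1}`) yields charts `ψ` and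
`V_{l+1} ⋐ V_l`; with `Φ_{l+1} = {θ ∘ ψ}` the same data hold for `l + 1` (bounds by the
one-variable recursion `iteratedDeriv_comp_bounds`). [cite: BhardwajVanDenDries2022, Cor. 6.4] -/
theorem lastVariable_Ck_step {p m n k : ℕ} (hO : L.IsOMinimal ℝ)
    (hadd : (univ : Set ℝ).Definable L {v : Fin 3 → ℝ | v 0 + v 1 = v 2})
    (hmul : (univ : Set ℝ).Definable L {v : Fin 3 → ℝ | v 0 * v 1 = v 2})
    (hk : 1 ≤ k) {l : ℕ} (hl : l < k)
    (U : Set (Fin (p + (m + 1)) → ℝ)) (hU : (univ : Set ℝ).Definable L U)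
    (hUcube : ∀ v : Fin p → ℝ, {x : Fin (m + 1) → ℝ | (Fin.append v x :) ∈ U} ⊆ 𝕀^(m + 1))
    (hUbig : ∀ v : Fin p → ℝ, interior (𝕀^(m + 1) \ {x : Fin (m + 1) → ℝ | (Fin.append v x :) ∈ U}) = ∅)
    (f : Fin n → (Fin (p + (m + 1)) → ℝ) → ℝ) (hf : ∀ c, (univ : Set ℝ).DefinableFun L (f c))
    {Kl : Type} [Fintype Kl] (θ : Kl → (Fin p → ℝ) → ℝ → ℝ) (hθdef : ∀ j, IsDefinableFamily₁ L (θ j))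
    (Vl : Set (Fin (p + (m + 1)) → ℝ)) (hVldef : (univ : Set ℝ).Definable L Vl)
    {Cθ Bl : ℝ} (hCθ : 1 ≤ Cθ) (hBl : 1 ≤ Bl)
    (hPl : ∀ v : Fin p → ℝ,
      (∀ j, StrictMonoOn (θ j v) (Ioo 0 1) ∨ StrictAntiOn (θ j v) (Ioo 0 1)) ∧
      (∀ j, MapsTo (θ j v) (Ioo 0 1) (Ioo 0 1)) ∧
      (∀ j, ContDiffOn ℝ k (θ j v) (Ioo 0 1)) ∧
      (∀ j, ∀ i ≤ k, ∀ t ∈ Ioo (0 : ℝ) 1, |iteratedDerivWithin i (θ j v) (Ioo 0 1) t| ≤ Cθ) ∧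
      (Ioo (0 : ℝ) 1 \ ⋃ j, θ j v '' Ioo 0 1).Finite ∧
      {x : Fin (m + 1) → ℝ | (Fin.append v x :) ∈ Vl} ⊆ {x | (Fin.append v x :) ∈ U} ∧
      IsOpen {x : Fin (m + 1) → ℝ | (Fin.append v x :) ∈ Vl} ∧
      interior ({x : Fin (m + 1) → ℝ | (Fin.append v x :) ∈ U} \ {x | (Fin.append v x :) ∈ Vl}) = ∅ ∧
      ∀ j, MapsTo (fun x : Fin (m + 1) → ℝ => Function.update x (Fin.last m) (θ j v (x (Fin.last m))))
            {x | (Fin.append v x :) ∈ Vl} {x | (Fin.append v x :) ∈ U} ∧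
        (∀ c, ContDiffOn ℝ k
          (fun x => f c (Fin.append v (Function.update x (Fin.last m) (θ j v (x (Fin.last m))))))
          {x | (Fin.append v x :) ∈ Vl}) ∧
        (∀ c, ∀ x : Fin (m + 1) → ℝ, (Fin.append v x :) ∈ Vl → ∀ w : List (Fin (m + 1)),
          w.length ≤ k → w.count (Fin.last m) ≤ l →
          |pderivWord w (fun x => f c (Fin.append v (Function.update x (Fin.last m) (θ j v (x (Fin.last m)))))) x| ≤ Bl)) :
    ∃ (Kl' : Type) (_ : Fintype Kl') (θ' : Kl' → (Fin p → ℝ) → ℝ → ℝ) (Vl' : Set (Fin (p + (m + 1)) → ℝ))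
      (Cθ' Bl' : ℝ), 1 ≤ Cθ' ∧ 1 ≤ Bl' ∧
      (∀ j, IsDefinableFamily₁ L (θ' j)) ∧ (univ : Set ℝ).Definable L Vl' ∧
      ∀ v : Fin p → ℝ,
      (∀ j, StrictMonoOn (θ' j v) (Ioo 0 1) ∨ StrictAntiOn (θ' j v) (Ioo 0 1)) ∧
      (∀ j, MapsTo (θ' j v) (Ioo 0 1) (Ioo 0 1)) ∧
      (∀ j, ContDiffOn ℝ k (θ' j v) (Ioo 0 1)) ∧
      (∀ j, ∀ i ≤ k, ∀ t ∈ Ioo (0 : ℝ) 1, |iteratedDerivWithin i (θ' j v) (Ioo 0 1) t| ≤ Cθ') ∧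
      (Ioo (0 : ℝ) 1 \ ⋃ j, θ' j v '' Ioo 0 1).Finite ∧
      {x : Fin (m + 1) → ℝ | (Fin.append v x :) ∈ Vl'} ⊆ {x | (Fin.append v x :) ∈ U} ∧
      IsOpen {x : Fin (m + 1) → ℝ | (Fin.append v x :) ∈ Vl'} ∧
      interior ({x : Fin (m + 1) → ℝ | (Fin.append v x :) ∈ U} \ {x | (Fin.append v x :) ∈ Vl'}) = ∅ ∧
      ∀ j, MapsTo (fun x : Fin (m + 1) → ℝ => Function.update x (Fin.last m) (θ' j v (x (Fin.last m))))
            {x | (Fin.append v x :) ∈ Vl'} {x | (Fin.append v x :) ∈ U} ∧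
        (∀ c, ContDiffOn ℝ k
          (fun x => f c (Fin.append v (Function.update x (Fin.last m) (θ' j v (x (Fin.last m))))))
          {x | (Fin.append v x :) ∈ Vl'}) ∧
        (∀ c, ∀ x : Fin (m + 1) → ℝ, (Fin.append v x :) ∈ Vl' → ∀ w : List (Fin (m + 1)),
          w.length ≤ k → w.count (Fin.last m) ≤ l + 1 →
          |pderivWord w (fun x => f c (Fin.append v (Function.update x (Fin.last m) (θ' j v (x (Fin.last m)))))) x| ≤ Bl') := by
  have hlt := definable_lt_of_field hadd hmul
  ----------------------------------------------------------------- (a) the functions `H_{j,c} = fe_c ∘ Tchg_j` and their canonical word partials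
  set fe : Fin n → (Fin (p + (m + 1)) → ℝ) → ℝ := fun c u => if u ∈ U then f c u else 0 with hfe
  have hfedef : ∀ c, (univ : Set ℝ).DefinableFun L (fe c) := fun c =>
    Set.DefinableFun.ite hU (hf c) (definableFun_const' _ _)
  set Tchg : Kl → (Fin (p + (m + 1)) → ℝ) → Fin (p + (m + 1)) → ℝ := fun j u =>
    Fin.append (fun i : Fin p => u (Fin.castAdd (m + 1) i))
      (Function.update (fun l : Fin (m + 1) => u (Fin.natAdd p l)) (Fin.last m)
        (θ j (fun i : Fin p => u (Fin.castAdd (m + 1) i)) (u (Fin.natAdd p (Fin.last m))))) with hTchg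
  have hTchgdef : ∀ j, (univ : Set ℝ).DefinableMap L (Tchg j) := by
    intro j l'
    refine Fin.addCases (fun i => ?_) (fun l'' => ?_) l'
    · simp only [hTchg, Fin.append_left]; exact definableFun_proj _
    · simp only [hTchg, Fin.append_right]
      by_cases hl'' : l'' = Fin.last m
      · subst hl''
        simp only [Function.update_self]
        exact (hθdef j).definableFun (fun i => definableFun_proj _) (definableFun_proj _)
      · simp only [Function.update_of_ne hl'']; exact definableFun_proj _
  set chg : Kl → (Fin p → ℝ) → (Fin (m + 1) → ℝ) → Fin (m + 1) → ℝ := fun j v x =>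
    Function.update x (Fin.last m) (θ j v (x (Fin.last m))) with hchg
  have hTchg_append : ∀ j v (x : Fin (m + 1) → ℝ), Tchg j (Fin.append v x) = Fin.append v (chg j v x) := by
    intro j v x; simp only [hTchg, hchg, Fin.append_left, Fin.append_right]
  set H : Kl → Fin n → (Fin (p + (m + 1)) → ℝ) → ℝ := fun j c u => fe c (Tchg j u) with hH
  have hHdef : ∀ j c, (univ : Set ℝ).DefinableFun L (H j c) := fun j c => (hfedef c).comp (hTchgdef j)
  -- `K_{j,c,v} = f_c ∘ (v, I_θ ·)`, the function of the statement; `H (v, y) = K y` on `Vl_v`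
  set Kf : Kl → Fin n → (Fin p → ℝ) → (Fin (m + 1) → ℝ) → ℝ := fun j c v x =>
    f c (Fin.append v (Function.update x (Fin.last m) (θ j v (x (Fin.last m))))) with hKf
  have hHK : ∀ j c v, EqOn (fun y => H j c (Fin.append v y)) (Kf j c v) {y | (Fin.append v y :) ∈ Vl} := by
    intro j c v y hy
    have hmaps : (Fin.append v (Function.update y (Fin.last m) (θ j v (y (Fin.last m)))) :) ∈ U :=
      ((hPl v).2.2.2.2.2.2.2.2 j).1 hy
    simp only [hH, hKf, hTchg_append, hfe, hchg]
    rw [if_pos hmaps]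
  obtain ⟨L', inst', ψb, hψb, hdef', -⟩ := exists_orderedRing_expansion (L := L) hadd hmul
  have hD : ∀ j c, ∃ D : List (Fin (p + (m + 1))) → (Fin (p + (m + 1)) → ℝ) → ℝ, D [] = H j c ∧
      (∀ w, (univ : Set ℝ).DefinableFun L (D w)) ∧
      ∀ (i : Fin (p + (m + 1))) w x d, HasPartialDerivAt (D w) i d x → D (i :: w) x = d := by
    intro j c
    have hH' : (univ : Set ℝ).DefinableFun L' (H j c) := by
      unfold Set.DefinableFun; exact (hdef' _).mpr (hHdef j c)
    obtain ⟨D, hD0, hDdef, hDspec⟩ := exists_wordPartials ψb hH'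
    exact ⟨D, hD0, fun w => by unfold Set.DefinableFun; exact (hdef' _).mp (hDdef w), hDspec⟩
  choose D hD0 hDdef hDspec using hD
  -- on `Vl_v`: `D_{w↑}(v, y) = ∂^w K (y)` for `|w| ≤ k`
  have hVlopen : ∀ v, IsOpen {y : Fin (m + 1) → ℝ | (Fin.append v y :) ∈ Vl} := fun v => (hPl v).2.2.2.2.2.2.1
  have hKfCk : ∀ j c v, ContDiffOn ℝ k (Kf j c v) {y | (Fin.append v y :) ∈ Vl} := fun j c v =>
    ((hPl v).2.2.2.2.2.2.2.2 j).2.1 c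
  have hDK : ∀ j c v (w : List (Fin (m + 1))), w.length ≤ k →
      EqOn (fun y => D j c (w.map (Fin.natAdd p)) (Fin.append v y)) (pderivWord w (Kf j c v)) {y | (Fin.append v y :) ∈ Vl} := by
    intro j c v w hw
    have hHk : ContDiffOn ℝ (k : WithTop ℕ∞) (fun y => H j c (Fin.append v y)) {y | (Fin.append v y :) ∈ Vl} :=
      (hKfCk j c v).congr (hHK j c v)
    have h := wordPartials_eq_pderivWord (hD0 j c) (hDspec j c) (hVlopen v) v hHk w hw
    refine h.trans ?_
    exact pderivWord_congr_of_eqOn (hVlopen v) (hHK j c v) w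
  ----------------------------------------------------------------- (b) the functions for Lemma 6.2
  set T : Type := Kl × Fin n × (Σ len : Fin k, (Fin len → Fin (m + 1))) with hT
  haveI : Fintype T := by rw [hT]; infer_instance
  set wd : T → List (Fin (m + 1)) := fun τ => List.ofFn τ.2.2.2 with hwd
  have hwdlen : ∀ τ, (wd τ).length < k := fun τ => by simp [hwd]
  set g : T → (Fin (p + (m + 1)) → ℝ) → ℝ := fun τ u =>
    if (wd τ).count (Fin.last m) ≤ l then Bl⁻¹ * D τ.1 τ.2.1 ((wd τ).map (Fin.natAdd p)) u else 0 with hg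
  have hgdef : ∀ τ, (univ : Set ℝ).DefinableFun L (g τ) := by
    intro τ
    simp only [hg]
    split_ifs
    · exact definableFun_mul hmul (definableFun_const' _ _) (hDdef _ _ _)
    · exact definableFun_const' _ _
  set NT : ℕ := Fintype.card T with hNT
  set eT : T ≃ Fin NT := Fintype.equivFin T with heT
  set fN : Fin NT → (Fin (p + (m + 1)) → ℝ) → ℝ := fun c' => g (eT.symm c') with hfN
  have hfNdef : ∀ c', (univ : Set ℝ).DefinableFun L (fN c') := fun c' => hgdef _
  have hBl0 : 0 < Bl := by linarith
  -- on `Vl_v` the active functions are `Bl⁻¹ ∂^w K`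
  have hgK : ∀ τ v, (wd τ).count (Fin.last m) ≤ l →
      EqOn (fun y => g τ (Fin.append v y)) (fun y => Bl⁻¹ * pderivWord (wd τ) (Kf τ.1 τ.2.1 v) y)
        {y | (Fin.append v y :) ∈ Vl} := by
    intro τ v hcount y hy
    simp only [hg, hcount, if_true]
    have h := hDK τ.1 τ.2.1 v (wd τ) (hwdlen τ).le hy
    simp only at h
    rw [h]
  -- smoothness of `∂^w K` on `Vl_v`
  have hKW : ∀ j c v (w : List (Fin (m + 1))) (q : ℕ), q + w.length ≤ k →
      ContDiffOn ℝ (q : WithTop ℕ∞) (pderivWord w (Kf j c v)) {y | (Fin.append v y :) ∈ Vl} := by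
    intro j c v w q hq
    have h1 : ContDiffOn ℝ ((q + w.length : ℕ) : WithTop ℕ∞) (Kf j c v) {y | (Fin.append v y :) ∈ Vl} :=
      (hKfCk j c v).of_le (by exact_mod_cast hq)
    exact ContDiffOn.pderivWord (hVlopen v) w h1
  ----------------------------------------------------------------- (c) the hypotheses of Lemma 6.2 on `Vl`
  have hVlU : ∀ v, {y : Fin (m + 1) → ℝ | (Fin.append v y :) ∈ Vl} ⊆ {y | (Fin.append v y :) ∈ U} :=
    fun v => (hPl v).2.2.2.2.2.1
  have hVlcube : ∀ v, {y : Fin (m + 1) → ℝ | (Fin.append v y :) ∈ Vl} ⊆ 𝕀^(m + 1) :=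
    fun v => (hVlU v).trans (hUcube v)
  have hcubedef : (univ : Set ℝ).Definable L (𝕀^(m + 1) : Set (Fin (m + 1) → ℝ)) := by
    have h := definable_iInter_of_finite (L := L) (A := (univ : Set ℝ))
      (f := fun i : Fin (m + 1) => {x : Fin (m + 1) → ℝ | 0 < x i ∧ x i < 1})
      (fun i => definable_setOf_and (definable_setOf_lt hlt (definableFun_const' _ _) (definableFun_proj _))
        (definable_setOf_lt hlt (definableFun_proj _) (definableFun_const' _ _)))
    convert h using 1
    ext x; simp [Set.mem_pi]
  have hVlbig : ∀ v, interior (𝕀^(m + 1) \ {y : Fin (m + 1) → ℝ | (Fin.append v y :) ∈ Vl}) = ∅ := by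
    intro v
    have hsub : 𝕀^(m + 1) \ {y : Fin (m + 1) → ℝ | (Fin.append v y :) ∈ Vl} ⊆
        ⋃ b ∈ (Finset.univ : Finset Bool), (if b then 𝕀^(m + 1) \ {y : Fin (m + 1) → ℝ | (Fin.append v y :) ∈ U}
          else {y : Fin (m + 1) → ℝ | (Fin.append v y :) ∈ U} \ {y | (Fin.append v y :) ∈ Vl}) := by
      rintro y ⟨hyI, hyV⟩
      by_cases hyU : (Fin.append v y :) ∈ U
      · exact mem_iUnion₂.mpr ⟨false, Finset.mem_univ _, by simp only [Bool.false_eq_true, if_false]; exact ⟨hyU, hyV⟩⟩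
      · exact mem_iUnion₂.mpr ⟨true, Finset.mem_univ _, by simp only [if_true]; exact ⟨hyI, hyU⟩⟩
    have h := interior_biUnion_eq_empty_of_definable (Nat.succ_pos m) hO hlt (Finset.univ : Finset Bool)
      (fun b => if b then 𝕀^(m + 1) \ {y : Fin (m + 1) → ℝ | (Fin.append v y :) ∈ U}
          else {y : Fin (m + 1) → ℝ | (Fin.append v y :) ∈ U} \ {y | (Fin.append v y :) ∈ Vl})
      (fun b _ => by
        cases b
        · simp only [Bool.false_eq_true, if_false]; exact (definable_fibre_append hU v).sdiff (definable_fibre_append hVldef v)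
        · simp only [if_true]; exact hcubedef.sdiff (definable_fibre_append hU v))
      (fun b _ => by
        cases b
        · simp only [Bool.false_eq_true, if_false]; exact (hPl v).2.2.2.2.2.2.2.1
        · simp only [if_true]; exact hUbig v)
    exact subset_empty_iff.mp ((interior_mono hsub).trans h.subset)
  have hfNC1 : ∀ c' v, ContDiffOn ℝ 1 (fun x => fN c' (Fin.append v x)) {x | (Fin.append v x :) ∈ Vl} := by
    intro c' v
    set τ := eT.symm c' with hτ
    show ContDiffOn ℝ 1 (fun x => g τ (Fin.append v x)) {x | (Fin.append v x :) ∈ Vl}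
    by_cases hcount : (wd τ).count (Fin.last m) ≤ l
    · refine ContDiffOn.congr ?_ (hgK τ v hcount)
      have h := hKW τ.1 τ.2.1 v (wd τ) 1 (by have := hwdlen τ; omega)
      exact contDiffOn_const.mul (by exact_mod_cast h)
    · have : (fun x : Fin (m + 1) → ℝ => g τ (Fin.append v x)) = fun _ => 0 := by
        funext x; simp only [hg, hcount, if_false]
      rw [this]; exact contDiffOn_const
  have hfNbd : ∀ c' v, ∀ x : Fin (m + 1) → ℝ, (Fin.append v x :) ∈ Vl → |fN c' (Fin.append v x)| ≤ 1 := by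
    intro c' v x hx
    set τ := eT.symm c' with hτ
    show |g τ (Fin.append v x)| ≤ 1
    by_cases hcount : (wd τ).count (Fin.last m) ≤ l
    · have h := hgK τ v hcount hx
      simp only at h
      rw [h, abs_mul, abs_inv, abs_of_pos hBl0]
      have hb := ((hPl v).2.2.2.2.2.2.2.2 τ.1).2.2 τ.2.1 x hx (wd τ) (hwdlen τ).le hcount
      calc Bl⁻¹ * |pderivWord (wd τ) (Kf τ.1 τ.2.1 v) x| ≤ Bl⁻¹ * Bl :=
            mul_le_mul_of_nonneg_left hb (inv_nonneg.mpr hBl0.le)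
        _ = 1 := inv_mul_cancel₀ hBl0.ne'
    · simp only [hg, hcount, if_false, abs_zero]; exact zero_le_one
  have hfNB : ∀ c' v, ∀ x : Fin (m + 1) → ℝ, (Fin.append v x :) ∈ Vl →
      ∀ i : Fin m, |pderiv (Fin.castSucc i) (fun x => fN c' (Fin.append v x)) x| ≤ 1 := by
    intro c' v x hx i
    set τ := eT.symm c' with hτ
    show |pderiv (Fin.castSucc i) (fun x => g τ (Fin.append v x)) x| ≤ 1
    by_cases hcount : (wd τ).count (Fin.last m) ≤ l
    · rw [pderiv_congr_of_eqOn (hVlopen v) (hgK τ v hcount) (Fin.castSucc i) hx, pderiv_const_mul,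
        ← pderivWord_cons, abs_mul, abs_inv, abs_of_pos hBl0]
      have hcount' : (Fin.castSucc i :: wd τ).count (Fin.last m) ≤ l := by
        rw [List.count_cons]
        have : (Fin.castSucc i == Fin.last m) = false := beq_false_of_ne (Fin.castSucc_lt_last i).ne
        simp only [this, Bool.false_eq_true, if_false, add_zero]; exact hcount
      have hb := ((hPl v).2.2.2.2.2.2.2.2 τ.1).2.2 τ.2.1 x hx (Fin.castSucc i :: wd τ)
        (by rw [List.length_cons]; have := hwdlen τ; omega) hcount'
      calc Bl⁻¹ * |pderivWord (Fin.castSucc i :: wd τ) (Kf τ.1 τ.2.1 v) x| ≤ Bl⁻¹ * Bl :=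
            mul_le_mul_of_nonneg_left hb (inv_nonneg.mpr hBl0.le)
        _ = 1 := inv_mul_cancel₀ hBl0.ne'
    · have : (fun x : Fin (m + 1) → ℝ => g τ (Fin.append v x)) = fun _ => 0 := by
        funext y; simp only [hg, hcount, if_false]
      rw [this]
      simp [pderiv]
  ----------------------------------------------------------------- (d) Lemma 6.2 at order `k + 1`
  obtain ⟨Kψ, hKψ, ψ, V', hψdef, hV'def, hLV⟩ := lastVariable_step hO hadd hmul (k := k + 1) (by omega) Vl hVldef
    hVlopen hVlcube hVlbig fN hfNdef hfNC1 hfNbd (B₁ := 1) hfNB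
  ----------------------------------------------------------------- (e) the new data
  -- the constants of the one-variable recursion, for every horizontal length `e`
  have hR := fun e : ℕ => iteratedDeriv_comp_bounds k l e Bl (Bl * (3 + m)) (by linarith) (by positivity)
  choose Cf hCf0 hCf using hR
  set Bl' : ℝ := Bl + ∑ e ∈ Finset.range (k + 1), ∑ i ∈ Finset.range (k + 1), Cf e i with hBl'
  have hCfle : ∀ e ≤ k, ∀ i ≤ k, Cf e i ≤ Bl' := by
    intro e he i hi
    have h1 : Cf e i ≤ ∑ i' ∈ Finset.range (k + 1), Cf e i' :=
      Finset.single_le_sum (fun i' _ => hCf0 e i') (Finset.mem_range.mpr (by omega))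
    have h2 : ∑ i' ∈ Finset.range (k + 1), Cf e i' ≤ ∑ e' ∈ Finset.range (k + 1), ∑ i' ∈ Finset.range (k + 1), Cf e' i' :=
      Finset.single_le_sum (f := fun e' => ∑ i' ∈ Finset.range (k + 1), Cf e' i')
        (fun e' _ => Finset.sum_nonneg fun i' _ => hCf0 e' i') (Finset.mem_range.mpr (by omega))
    rw [hBl']; linarith
  have hBlBl' : Bl ≤ Bl' := by
    have : 0 ≤ ∑ e ∈ Finset.range (k + 1), ∑ i ∈ Finset.range (k + 1), Cf e i :=
      Finset.sum_nonneg fun e _ => Finset.sum_nonneg fun i _ => hCf0 e i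
    rw [hBl']; linarith
  set θ' : Kl × Kψ → (Fin p → ℝ) → ℝ → ℝ := fun jj v t => θ jj.1 v (ψ jj.2 v t) with hθ'
  refine ⟨Kl × Kψ, inferInstance, θ', V', (k.factorial : ℝ) * Cθ, Bl', ?_, by linarith, fun jj => (hθdef jj.1).comp₂ (hψdef jj.2),
    hV'def, fun v => ?_⟩
  · have : (1 : ℝ) ≤ k.factorial := by exact_mod_cast Nat.one_le_iff_ne_zero.mpr (Nat.factorial_ne_zero k)
    nlinarith
  obtain ⟨hmonoθ, hmapsθ, hCkθ, hbdθ, hcofθ, -, -, hVlbigU, hjθ⟩ := hPl v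
  obtain ⟨hmonoψ, hmapsψ, hCkψ', hbdψ', hcofψ, hV'Vl, hV'open, hV'big, hjψ⟩ := hLV v
  have hkk : k + 1 - 1 = k := Nat.add_sub_cancel k 1
  have hCkψ : ∀ jψ, ContDiffOn ℝ k (ψ jψ v) (Ioo 0 1) := fun jψ => by
    have h := hCkψ' jψ; rwa [hkk] at h
  have hbdψ : ∀ jψ, ∀ i ≤ k, ∀ t ∈ Ioo (0 : ℝ) 1, |iteratedDerivWithin i (ψ jψ v) (Ioo 0 1) t| ≤ 1 := fun jψ i hi =>
    hbdψ' jψ i (by omega)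
  set Uv : Set (Fin (m + 1) → ℝ) := {x | (Fin.append v x :) ∈ U} with hUv
  set Vlv : Set (Fin (m + 1) → ℝ) := {x | (Fin.append v x :) ∈ Vl} with hVlv
  set V'v : Set (Fin (m + 1) → ℝ) := {x | (Fin.append v x :) ∈ V'} with hV'v
  have hslabVl : Vlv ⊆ {x : Fin (m + 1) → ℝ | x (Fin.last m) ∈ Ioo (0 : ℝ) 1} := fun x hx =>
    hVlcube v hx (Fin.last m) (mem_univ _)
  have hslabV' : V'v ⊆ {x : Fin (m + 1) → ℝ | x (Fin.last m) ∈ Ioo (0 : ℝ) 1} := fun x hx => hslabVl (hV'Vl hx)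
  -- `I_{θ ∘ ψ} = I_θ ∘ I_ψ`
  have hII : ∀ (j : Kl) (jψ : Kψ) (x : Fin (m + 1) → ℝ),
      Function.update x (Fin.last m) (θ' (j, jψ) v (x (Fin.last m))) =
        Function.update (Function.update x (Fin.last m) (ψ jψ v (x (Fin.last m)))) (Fin.last m)
          (θ j v ((Function.update x (Fin.last m) (ψ jψ v (x (Fin.last m)))) (Fin.last m))) := by
    intro j jψ x
    rw [Function.update_idem, Function.update_self]
  have hKf' : ∀ (j : Kl) (jψ : Kψ) (c : Fin n),
      (fun x => f c (Fin.append v (Function.update x (Fin.last m) (θ' (j, jψ) v (x (Fin.last m)))))) =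
        fun x => Kf j c v (Function.update x (Fin.last m) (ψ jψ v (x (Fin.last m)))) := by
    intro j jψ c; funext x; simp only [hKf]; rw [hII]
  -- smoothness of `I_ψ` on the slab
  have hIψCk : ∀ jψ, ContDiffOn ℝ k (fun x : Fin (m + 1) → ℝ => Function.update x (Fin.last m) (ψ jψ v (x (Fin.last m))))
      {x : Fin (m + 1) → ℝ | x (Fin.last m) ∈ Ioo (0 : ℝ) 1} := by
    intro jψ
    rw [contDiffOn_pi]
    intro l'
    by_cases hl' : l' = Fin.last m
    · subst hl'
      simp only [Function.update_self]
      exact (hCkψ jψ).comp (contDiffOn_pi.mp contDiffOn_id (Fin.last m)) fun x hx => hx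
    · simp only [Function.update_of_ne hl']
      exact contDiffOn_pi.mp contDiffOn_id l'
  have hψdiff : ∀ jψ, ∀ x ∈ V'v, DifferentiableAt ℝ (ψ jψ v) (x (Fin.last m)) := fun jψ x hx =>
    ((hCkψ jψ).differentiableOn (by exact_mod_cast Nat.one_le_iff_ne_zero.mp hk) _ (hslabV' hx)).differentiableAt
      (isOpen_Ioo.mem_nhds (hslabV' hx))
  refine ⟨fun jj => ?_, fun jj => (hmapsθ jj.1).comp (hmapsψ jj.2), fun jj => (hCkθ jj.1).comp (hCkψ jj.2) (hmapsψ jj.2),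
    fun jj i hi t ht => ?_, ?_, hV'Vl.trans (hVlU v), hV'open, ?_, fun jj => ⟨?_, fun c => ?_, fun c x hx w hwlen hwcount => ?_⟩⟩
  · ------------------------------------------------------------- strictly monotone
    rcases hmonoθ jj.1 with h1 | h1 <;> rcases hmonoψ jj.2 with h2 | h2
    · exact Or.inl fun x hx y hy hxy => h1 (hmapsψ _ hx) (hmapsψ _ hy) (h2 hx hy hxy)
    · exact Or.inr fun x hx y hy hxy => h1 (hmapsψ _ hy) (hmapsψ _ hx) (h2 hx hy hxy)
    · exact Or.inr fun x hx y hy hxy => h1 (hmapsψ _ hx) (hmapsψ _ hy) (h2 hx hy hxy)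
    · exact Or.inl fun x hx y hy hxy => h1 (hmapsψ _ hy) (hmapsψ _ hx) (h2 hx hy hxy)
  · ------------------------------------------------------------- derivative bounds of `θ ∘ ψ`
    have h := abs_iteratedDerivWithin_comp_le isOpen_Ioo isOpen_Ioo (n := i) (C := Cθ)
      ((hCkθ jj.1).of_le (by exact_mod_cast hi)) ((hCkψ jj.2).of_le (by exact_mod_cast hi)) (hmapsψ jj.2)
      (fun q hq y hy => hbdθ jj.1 q (hq.trans hi) y hy) (fun q hq1 hq y hy => hbdψ jj.2 q (hq.trans hi) y hy) ht
    refine h.trans ?_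
    have h1 : (i.factorial : ℝ) ≤ k.factorial := by exact_mod_cast Nat.factorial_le hi
    have h2 : (0 : ℝ) ≤ Cθ := by linarith
    nlinarith
  · ------------------------------------------------------------- cofinite cover
    set Eψ : Set ℝ := Ioo (0 : ℝ) 1 \ ⋃ jψ, ψ jψ v '' Ioo 0 1 with hEψ
    refine (hcofθ.union (finite_iUnion fun j : Kl => hcofψ.image (θ j v))).subset ?_
    rintro y ⟨hy, hnot⟩
    by_cases hyθ : y ∈ ⋃ j, θ j v '' Ioo 0 1
    · right
      obtain ⟨j, t, ht, rfl⟩ := by simpa only [mem_iUnion, mem_image] using hyθ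
      refine mem_iUnion.mpr ⟨j, t, ⟨ht, fun htψ => hnot ?_⟩, rfl⟩
      obtain ⟨jψ, s, hs, rfl⟩ := by simpa only [mem_iUnion, mem_image] using htψ
      exact mem_iUnion.mpr ⟨(j, jψ), s, hs, rfl⟩
    · exact Or.inl ⟨hy, hyθ⟩
  · ------------------------------------------------------------- `V' ⋐ U`
    have hsub : Uv \ V'v ⊆ ⋃ b ∈ (Finset.univ : Finset Bool), (if b then Uv \ Vlv else Vlv \ V'v) := by
      rintro y ⟨hyU, hyV'⟩
      by_cases hyVl : y ∈ Vlv
      · exact mem_iUnion₂.mpr ⟨false, Finset.mem_univ _, by simp only [Bool.false_eq_true, if_false]; exact ⟨hyVl, hyV'⟩⟩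
      · exact mem_iUnion₂.mpr ⟨true, Finset.mem_univ _, by simp only [if_true]; exact ⟨hyU, hyVl⟩⟩
    have h := interior_biUnion_eq_empty_of_definable (Nat.succ_pos m) hO hlt (Finset.univ : Finset Bool)
      (fun b => if b then Uv \ Vlv else Vlv \ V'v)
      (fun b _ => by
        cases b
        · simp only [Bool.false_eq_true, if_false]; exact (definable_fibre_append hVldef v).sdiff (definable_fibre_append hV'def v)
        · simp only [if_true]; exact (definable_fibre_append hU v).sdiff (definable_fibre_append hVldef v))
      (fun b _ => by
        cases b
        · simp only [Bool.false_eq_true, if_false]; exact hV'big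
        · simp only [if_true]; exact hVlbigU)
    exact subset_empty_iff.mp ((interior_mono hsub).trans h.subset)
  · ------------------------------------------------------------- `I_{θ∘ψ}(V') ⊆ U`
    intro x hx
    show (Fin.append v (Function.update x (Fin.last m) (θ' jj v (x (Fin.last m)))) :) ∈ U
    rw [show jj = (jj.1, jj.2) from rfl, hII]
    exact (hjθ jj.1).1 ((hjψ jj.2).1 hx)
  · ------------------------------------------------------------- `f_c ∘ I_{θ∘ψ}` is `C^k` on `V'`
    rw [show jj = (jj.1, jj.2) from rfl, hKf']
    exact (hKfCk jj.1 c v).comp ((hIψCk jj.2).mono hslabV') (hjψ jj.2).1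
  · ------------------------------------------------------------- the bounds
    obtain ⟨j, jψ⟩ := jj
    rw [hKf']
    set K : (Fin (m + 1) → ℝ) → ℝ := Kf j c v with hKdef
    set ψv : ℝ → ℝ := ψ jψ v with hψv
    set Iψ : (Fin (m + 1) → ℝ) → Fin (m + 1) → ℝ := fun x => Function.update x (Fin.last m) (ψv (x (Fin.last m))) with hIψ
    have hxV : x ∈ V'v := hx
    have hO : IsOpen V'v := hV'open
    have hO' : IsOpen Vlv := hVlopen v
    have hKCk : ContDiffOn ℝ k K Vlv := hKfCk j c v
    have hmapsI : MapsTo Iψ V'v Vlv := (hjψ jψ).1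
    have hKI : ContDiffOn ℝ k (fun x => K (Iψ x)) V'v := hKCk.comp ((hIψCk jψ).mono hslabV') hmapsI
    -- reorder the word: `last` letters first
    obtain ⟨j', wh, hj', hlen, hperm⟩ := perm_replicate_append_horizontal w
    rw [pderivWord_perm hO hperm (hKI.of_le (by exact_mod_cast hwlen)) hxV]
    have hj'l : j' ≤ l + 1 := hj' ▸ hwcount
    have hje : j' + wh.length ≤ k := by omega
    -- horizontal part through `I_ψ`
    have hhor : EqOn (pderivWord (wh.map Fin.castSucc) (fun x => K (Iψ x)))
        (fun x => pderivWord (wh.map Fin.castSucc) K (Iψ x)) V'v :=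
      pderivWord_map_castSucc_comp_changeLast hO hO' (hψdiff jψ) hmapsI wh
        (hKCk.of_le (by exact_mod_cast (show wh.length ≤ k by omega)))
    rcases Nat.eq_zero_or_pos j' with hj0 | hjpos
    · ----------------------------------------------------------- no `last` letters
      subst hj0
      simp only [List.replicate_zero, List.nil_append]
      rw [hhor hxV]
      have hcount0 : (wh.map Fin.castSucc).count (Fin.last m) = 0 :=
        List.count_eq_zero.mpr fun hmem => by
          obtain ⟨a, -, ha⟩ := List.mem_map.mp hmem
          exact (Fin.castSucc_lt_last a).ne ha
      have hb := (hjθ j).2.2 c (Iψ x) (hmapsI hxV) (wh.map Fin.castSucc) (by rw [List.length_map]; omega)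
        (by rw [hcount0]; exact Nat.zero_le _)
      exact hb.trans hBlBl'
    ----------------------------------------------------------- `j' ≥ 1`: the one-variable recursion
    rw [pderivWord_replicate_append hO j' wh (hKI.of_le (by exact_mod_cast hje)) hxV]
    -- the sections `h r`
    set h : ℕ → ℝ → ℝ := fun r s => pderivWord (List.replicate r (Fin.last m) ++ wh.map Fin.castSucc) K
      (Function.update x (Fin.last m) s) with hh
    set J : Set ℝ := {s | Function.update x (Fin.last m) s ∈ V'v} with hJ
    set J' : Set ℝ := {s | Function.update x (Fin.last m) s ∈ Vlv} with hJ'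
    have hupd : Continuous fun s : ℝ => Function.update x (Fin.last m) s := by fun_prop
    have hJopen : IsOpen J := hO.preimage hupd
    have hJ'open : IsOpen J' := hO'.preimage hupd
    have hxJ : x (Fin.last m) ∈ J := by simp [hJ, hxV]
    have hJI : J ⊆ Ioo (0 : ℝ) 1 := fun s hs => by
      have := hslabV' hs; simpa using this
    -- `I_ψ (update x last s) = update x last (ψ s)`
    have hIupd : ∀ s, Iψ (Function.update x (Fin.last m) s) = Function.update x (Fin.last m) (ψv s) := by
      intro s; simp only [hIψ, Function.update_self, Function.update_idem]
    -- the section of `∂^{wh↑}(K ∘ I_ψ)` is `h 0 ∘ ψ` on `J`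
    have hsec : EqOn (fun s => pderivWord (wh.map Fin.castSucc) (fun x => K (Iψ x)) (Function.update x (Fin.last m) s))
        (fun s => h 0 (ψv s)) J := by
      intro s hs
      simp only [hh, List.replicate_zero, List.nil_append]
      rw [hhor hs]
      simp only [hIupd]
    rw [← iteratedDerivWithin_of_isOpen hJopen hxJ,
      iteratedDerivWithin_congr (n := j') hsec hxJ]
    -- the recursion lemma
    refine (hCf wh.length hJopen hJ'open ψv h ((hCkψ jψ).mono hJI) (fun s hs => ?_) (fun q hq1 hq s hs => ?_)
      (fun r hr => ?_) (fun r hr y hy => ?_) (fun r hrl hre y hy => ?_) (fun r hrl hre s hs => ?_)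
      j' 0 hjpos (by omega) (by omega) _ hxJ).trans (hCfle wh.length (by omega) j' (by omega))
    · -- `MapsTo ψ J J'`
      show Function.update x (Fin.last m) (ψv s) ∈ Vlv
      rw [← hIupd]; exact hmapsI hs
    · -- `|ψ^{(q)}| ≤ 1` within `J`
      rw [iteratedDerivWithin_congr_right_of_isOpen ψv q hJopen isOpen_Ioo ⟨hs, hJI hs⟩]
      exact hbdψ jψ q hq s (hJI hs)
    · -- smoothness of `h r` on `J'`
      have hW : ContDiffOn ℝ ((k - r - wh.length : ℕ) : WithTop ℕ∞)
          (pderivWord (List.replicate r (Fin.last m) ++ wh.map Fin.castSucc) K) Vlv := by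
        refine ContDiffOn.pderivWord hO' _ (hKCk.of_le ?_)
        simp only [List.length_append, List.length_replicate, List.length_map]
        exact_mod_cast (show k - r - wh.length + (r + wh.length) ≤ k by omega)
      exact hW.comp (contDiff_update _ x (Fin.last m)).contDiffOn fun y hy => hy
    · -- `(h r)' = h (r + 1)` on `J'`
      have hW : ContDiffOn ℝ 1 (pderivWord (List.replicate r (Fin.last m) ++ wh.map Fin.castSucc) K) Vlv := by
        refine ContDiffOn.pderivWord hO' _ (hKCk.of_le ?_)
        simp only [List.length_append, List.length_replicate, List.length_map]
        exact_mod_cast (show 1 + (r + wh.length) ≤ k by omega)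
      have hWd : DifferentiableAt ℝ (pderivWord (List.replicate r (Fin.last m) ++ wh.map Fin.castSucc) K)
          (Function.update x (Fin.last m) y) :=
        (hW.differentiableOn one_ne_zero _ hy).differentiableAt (hO'.mem_nhds hy)
      have h1 : h (r + 1) y = pderiv (Fin.last m) (pderivWord (List.replicate r (Fin.last m) ++ wh.map Fin.castSucc) K)
          (Function.update x (Fin.last m) y) := by
        simp only [hh, List.replicate_succ, List.cons_append, pderivWord_cons]
      rw [h1, pderiv_eq_deriv_section hWd, derivWithin_of_isOpen hJ'open hy]
      simp only [Function.update_idem, Function.update_self, hh]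
    · -- `|h r| ≤ Bl` on `J'`
      simp only [hh]
      refine (hjθ j).2.2 c _ hy _ ?_ ?_
      · simp only [List.length_append, List.length_replicate, List.length_map]; omega
      · rw [List.count_append, List.count_replicate_self]
        have : (wh.map Fin.castSucc).count (Fin.last m) = 0 :=
          List.count_eq_zero.mpr fun hmem => by
            obtain ⟨a, -, ha⟩ := List.mem_map.mp hmem
            exact (Fin.castSucc_lt_last a).ne ha
        rw [this, add_zero]; exact hrl
    · -- `|(h r ∘ ψ)'| ≤ Bl (3 + m)` on `J`: the output of Lemma 6.2
      -- the index of the function `Bl⁻¹ ∂^{w''} K`, `w'' = last^r ++ wh↑`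
      set w'' : List (Fin (m + 1)) := List.replicate r (Fin.last m) ++ wh.map Fin.castSucc with hw''
      have hw''len : w''.length = r + wh.length := by
        simp [hw'']
      have hw''k : w''.length < k := by omega
      set τ : T := (j, c, ⟨⟨w''.length, hw''k⟩, w''.get⟩) with hτ
      have hwdτ : wd τ = w'' := by simp [hwd, hτ, List.ofFn_get]
      have hcountτ : (wd τ).count (Fin.last m) ≤ l := by
        rw [hwdτ, hw'', List.count_append, List.count_replicate_self]
        have : (wh.map Fin.castSucc).count (Fin.last m) = 0 :=
          List.count_eq_zero.mpr fun hmem => by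
            obtain ⟨a, -, ha⟩ := List.mem_map.mp hmem
            exact (Fin.castSucc_lt_last a).ne ha
        rw [this, add_zero]; exact hrl
      set c' : Fin NT := eT τ with hc'
      have hfNτ : ∀ u, fN c' u = g τ u := fun u => by simp [hfN, hc']
      -- the bound of Lemma 6.2 at `x' = update x last s`
      set x' : Fin (m + 1) → ℝ := Function.update x (Fin.last m) s with hx'
      have hx'V : x' ∈ V'v := hs
      have hb := (hjψ jψ).2.2 c' x' hx'V (Fin.last m)
      -- identify the function
      have hEq : EqOn (fun y => fN c' (Fin.append v (Function.update y (Fin.last m) (ψ jψ v (y (Fin.last m))))))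
          (fun y => Bl⁻¹ * pderivWord w'' K (Iψ y)) V'v := by
        intro y hy'
        simp only [hfNτ]
        have h := hgK τ v hcountτ (hmapsI hy')
        simp only at h
        rw [hwdτ] at h
        exact h
      rw [pderiv_congr_of_eqOn hO hEq (Fin.last m) hx'V, pderiv_const_mul, abs_mul, abs_inv, abs_of_pos hBl0] at hb
      have hb' : |pderiv (Fin.last m) (fun y => pderivWord w'' K (Iψ y)) x'| ≤ Bl * (3 + m) := by
        have h3 : max (1 : ℝ) (3 + m * 1) = 3 + m := by
          rw [mul_one]; exact max_eq_right (by have : (0:ℝ) ≤ m := Nat.cast_nonneg m; linarith)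
        rw [h3] at hb
        have := mul_le_mul_of_nonneg_left hb hBl0.le
        rwa [← mul_assoc, mul_inv_cancel₀ hBl0.ne', one_mul] at this
      -- `∂_{m+1}` of `∂^{w''}K ∘ I_ψ` at `x'` is the derivative of `h r ∘ ψ` at `s`
      have hW : ContDiffOn ℝ 1 (pderivWord w'' K) Vlv := by
        refine ContDiffOn.pderivWord hO' _ (hKCk.of_le ?_)
        exact_mod_cast (show 1 + w''.length ≤ k by omega)
      have hWd : DifferentiableAt ℝ (pderivWord w'' K) (Iψ x') :=
        (hW.differentiableOn one_ne_zero _ (hmapsI hx'V)).differentiableAt (hO'.mem_nhds (hmapsI hx'V))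
      have hcompd : DifferentiableAt ℝ (fun y => pderivWord w'' K (Iψ y)) x' :=
        hWd.comp x' (differentiableAt_changeLast (hψdiff jψ x' hx'V))
      rw [pderiv_eq_deriv_section hcompd (Fin.last m)] at hb'
      have hsec' : (fun s'' => pderivWord w'' K (Iψ (Function.update x' (Fin.last m) s''))) = fun s'' => h r (ψv s'') := by
        funext s''
        simp only [hh, hx', Function.update_idem, hIupd, hw'']
      rw [hsec', show x' (Fin.last m) = s from (by simp [hx'])] at hb'
      rwa [derivWithin_of_isOpen hJopen hs]

/-- Iterated derivatives of the identity chart within `(0,1)`. [folklore] -/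
theorem abs_iteratedDerivWithin_id_le (i : ℕ) {t : ℝ} (ht : t ∈ Ioo (0 : ℝ) 1) :
    |iteratedDerivWithin i (fun s : ℝ => s) (Ioo 0 1) t| ≤ 1 := by
  rcases i with _ | i
  · rw [iteratedDerivWithin_zero, abs_of_pos ht.1]; exact ht.2.le
  · rw [iteratedDerivWithin_succ']
    have h1 : EqOn (derivWithin (fun s : ℝ => s) (Ioo 0 1)) (fun _ => (1 : ℝ)) (Ioo 0 1) := fun y hy => by
      rw [derivWithin_of_isOpen isOpen_Ioo hy]; exact deriv_id y
    rw [iteratedDerivWithin_congr h1 ht]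
    rcases i with _ | i
    · simp
    · rw [iteratedDerivWithin_const]; simp

/-- **Bhardwaj–van den Dries 2022, Cor. 6.4, uniformly in parameters over `ℝ`, vector-valued**
(*"for every `l ≤ k` there is a `V_l ⋐ U` and a `k`-parametrization `Φ_l` of a cofinite
subset of `(0,1)` such that for all `φ ∈ Φ_l`: `I_φ(V_l) ⊆ U`, `f_φ` is of class `C^k` on
`V_l` and `f_φ^{(α)}` is strongly bounded on `V_l` for all `α` with `|α| ≤ k`,
`α_{m+1} ≤ l`"*), the case `l = k`: for definable families of open `U_v ⋐ (0,1)^{m+1}` and of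
functions `f_c(v,·)` whose sections `y ↦ f_c(v, y, t)` are `C^k` with `‖D^q‖ ≤ B` (`q ≤ k`)
on the fibres of `U_v`, one gets finitely many definable families of strictly monotone
`C^k` unary charts with bounded derivatives covering `(0,1)` up to finitely many points and a
definable `V ⋐ U` on whose fibres all `f_c ∘ I_θ` are `C^k` with all word partials of length
`≤ k` bounded by a uniform constant.  Base `l = 0`: `Φ_0 = {id}` and `V_0 =` the `C^k` locus
(`exists_contDiffOn_locus_family_of_field`); step: `lastVariable_Ck_step`.
[cite: BhardwajVanDenDries2022, Cor. 6.4] -/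
theorem lastVariable_Ck {p m n k : ℕ} (hO : L.IsOMinimal ℝ)
    (hadd : (univ : Set ℝ).Definable L {v : Fin 3 → ℝ | v 0 + v 1 = v 2})
    (hmul : (univ : Set ℝ).Definable L {v : Fin 3 → ℝ | v 0 * v 1 = v 2})
    (hk : 1 ≤ k)
    (U : Set (Fin (p + (m + 1)) → ℝ)) (hU : (univ : Set ℝ).Definable L U)
    (hUopen : ∀ v : Fin p → ℝ, IsOpen {x : Fin (m + 1) → ℝ | (Fin.append v x :) ∈ U})
    (hUcube : ∀ v : Fin p → ℝ, {x : Fin (m + 1) → ℝ | (Fin.append v x :) ∈ U} ⊆ 𝕀^(m + 1))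
    (hUbig : ∀ v : Fin p → ℝ, interior (𝕀^(m + 1) \ {x : Fin (m + 1) → ℝ | (Fin.append v x :) ∈ U}) = ∅)
    (f : Fin n → (Fin (p + (m + 1)) → ℝ) → ℝ) (hf : ∀ c, (univ : Set ℝ).DefinableFun L (f c))
    {B : ℝ}
    (hsecCk : ∀ c (v : Fin p → ℝ) (t : ℝ), ContDiffOn ℝ k (fun y : Fin m → ℝ => f c (Fin.append v (Fin.snoc y t)))
      {y | (Fin.append v (Fin.snoc y t) :) ∈ U})
    (hsecbd : ∀ c (v : Fin p → ℝ) (t : ℝ), ∀ y : Fin m → ℝ, (Fin.append v (Fin.snoc y t) :) ∈ U →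
      ∀ q ≤ k, ‖iteratedFDeriv ℝ q (fun y : Fin m → ℝ => f c (Fin.append v (Fin.snoc y t))) y‖ ≤ B) :
    ∀ l ≤ k, ∃ (Kl : Type) (_ : Fintype Kl) (θ : Kl → (Fin p → ℝ) → ℝ → ℝ) (Vl : Set (Fin (p + (m + 1)) → ℝ))
      (Cθ Bl : ℝ), 1 ≤ Cθ ∧ 1 ≤ Bl ∧
      (∀ j, IsDefinableFamily₁ L (θ j)) ∧ (univ : Set ℝ).Definable L Vl ∧
      ∀ v : Fin p → ℝ,
      (∀ j, StrictMonoOn (θ j v) (Ioo 0 1) ∨ StrictAntiOn (θ j v) (Ioo 0 1)) ∧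
      (∀ j, MapsTo (θ j v) (Ioo 0 1) (Ioo 0 1)) ∧
      (∀ j, ContDiffOn ℝ k (θ j v) (Ioo 0 1)) ∧
      (∀ j, ∀ i ≤ k, ∀ t ∈ Ioo (0 : ℝ) 1, |iteratedDerivWithin i (θ j v) (Ioo 0 1) t| ≤ Cθ) ∧
      (Ioo (0 : ℝ) 1 \ ⋃ j, θ j v '' Ioo 0 1).Finite ∧
      {x : Fin (m + 1) → ℝ | (Fin.append v x :) ∈ Vl} ⊆ {x | (Fin.append v x :) ∈ U} ∧
      IsOpen {x : Fin (m + 1) → ℝ | (Fin.append v x :) ∈ Vl} ∧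
      interior ({x : Fin (m + 1) → ℝ | (Fin.append v x :) ∈ U} \ {x | (Fin.append v x :) ∈ Vl}) = ∅ ∧
      ∀ j, MapsTo (fun x : Fin (m + 1) → ℝ => Function.update x (Fin.last m) (θ j v (x (Fin.last m))))
            {x | (Fin.append v x :) ∈ Vl} {x | (Fin.append v x :) ∈ U} ∧
        (∀ c, ContDiffOn ℝ k
          (fun x => f c (Fin.append v (Function.update x (Fin.last m) (θ j v (x (Fin.last m))))))
          {x | (Fin.append v x :) ∈ Vl}) ∧
        (∀ c, ∀ x : Fin (m + 1) → ℝ, (Fin.append v x :) ∈ Vl → ∀ w : List (Fin (m + 1)),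
          w.length ≤ k → w.count (Fin.last m) ≤ l →
          |pderivWord w (fun x => f c (Fin.append v (Function.update x (Fin.last m) (θ j v (x (Fin.last m)))))) x| ≤ Bl) := by
  have hlt := definable_lt_of_field hadd hmul
  intro l
  induction l with
  | succ l ih =>
    intro hl
    obtain ⟨Kl, hKl, θ, Vl, Cθ, Bl, hCθ, hBl, hθdef, hVldef, hPl⟩ := ih (by omega)
    exact lastVariable_Ck_step hO hadd hmul hk (by omega) U hU hUcube hUbig f hf θ hθdef Vl hVldef hCθ hBl hPl
  | zero =>
  intro _
  ----------------------------------------------------------------- the base case `l = 0`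
  set fe : Fin n → (Fin (p + (m + 1)) → ℝ) → ℝ := fun c u => if u ∈ U then f c u else 0 with hfe
  have hfedef : ∀ c, (univ : Set ℝ).DefinableFun L (fe c) := fun c =>
    Set.DefinableFun.ite hU (hf c) (definableFun_const' _ _)
  have hG := fun c => exists_contDiffOn_locus_family_of_field hO hadd hmul (p := p) (n := m + 1) (Nat.succ_pos m)
    (hfedef c) k hk
  choose G hGdef hG using hG
  set V0 : Set (Fin (p + (m + 1)) → ℝ) := U ∩ ⋂ c, G c with hV0
  have hV0def : (univ : Set ℝ).Definable L V0 := hU.inter (definable_iInter_of_finite hGdef)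
  refine ⟨Unit, inferInstance, fun _ _ t => t, V0, 1, max B 1, le_rfl, le_max_right _ _, fun _ => IsDefinableFamily₁.id, hV0def,
    fun v => ?_⟩
  set Uv : Set (Fin (m + 1) → ℝ) := {x | (Fin.append v x :) ∈ U} with hUv
  have hV0fib : {x : Fin (m + 1) → ℝ | (Fin.append v x :) ∈ V0} = Uv ∩ ⋂ c, {x | (Fin.append v x :) ∈ G c} := by
    ext x; simp [hV0, hUv]
  have hid : ∀ x : Fin (m + 1) → ℝ, Function.update x (Fin.last m) (x (Fin.last m)) = x := fun x => Function.update_eq_self _ _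
  have hV0U : {x : Fin (m + 1) → ℝ | (Fin.append v x :) ∈ V0} ⊆ Uv := fun x hx => by rw [hV0fib] at hx; exact hx.1
  have hV0open : IsOpen {x : Fin (m + 1) → ℝ | (Fin.append v x :) ∈ V0} := by
    rw [hV0fib]; exact (hUopen v).inter (isOpen_iInter_of_finite fun c => (hG c v).1)
  -- `f_c ∘ (v, ·)` is `C^k` on `V0_v`
  have hfeU : ∀ c, EqOn (fun x => fe c (Fin.append v x)) (fun x => f c (Fin.append v x)) Uv := fun c x hx => by
    simp only [hfe, mem_setOf_eq.mp hx, if_true]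
  have hfCk : ∀ c, ContDiffOn ℝ k (fun x => f c (Fin.append v x)) {x : Fin (m + 1) → ℝ | (Fin.append v x :) ∈ V0} := by
    intro c
    refine (((hG c v).2.1).mono fun x hx => ?_).congr fun x hx => (hfeU c (hV0U hx)).symm
    rw [hV0fib] at hx; exact mem_iInter.mp hx.2 c
  refine ⟨fun _ => Or.inl fun x _ y _ hxy => hxy, fun _ t ht => ht, fun _ => contDiffOn_id, fun _ i _ t ht => abs_iteratedDerivWithin_id_le i ht,
    ?_, hV0U, hV0open, ?_, fun _ => ⟨fun x hx => by simpa only [hid] using hV0U hx, fun c => ?_, fun c x hx w hwlen hwcount => ?_⟩⟩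
  · -- cover: the identity chart is onto
    have : Ioo (0 : ℝ) 1 \ ⋃ _j : Unit, (fun t : ℝ => t) '' Ioo 0 1 = ∅ := by
      ext y; simp
    rw [this]; exact finite_empty
  · -- `V0 ⋐ U`
    have hsub : Uv \ {x : Fin (m + 1) → ℝ | (Fin.append v x :) ∈ V0} ⊆ ⋃ c ∈ (Finset.univ : Finset (Fin n)),
        {x : Fin (m + 1) → ℝ | (Fin.append v x :) ∈ G c}ᶜ := by
      rintro x ⟨hxU, hxV⟩
      rw [hV0fib] at hxV
      simp only [mem_inter_iff, mem_iInter, not_and, not_forall] at hxV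
      obtain ⟨c, hc⟩ := hxV hxU
      exact mem_iUnion₂.mpr ⟨c, Finset.mem_univ _, hc⟩
    have h := interior_biUnion_eq_empty_of_definable (Nat.succ_pos m) hO hlt (Finset.univ : Finset (Fin n))
      (fun c => {x : Fin (m + 1) → ℝ | (Fin.append v x :) ∈ G c}ᶜ)
      (fun c _ => (definable_fibre_append (hGdef c) v).compl) (fun c _ => (hG c v).2.2)
    exact subset_empty_iff.mp ((interior_mono hsub).trans h.subset)
  · simpa only [hid] using hfCk c
  · -- bounds for horizontal words (no letter `last`)
    simp only [hid]
    have hcount0 : w.count (Fin.last m) = 0 := Nat.le_zero.mp hwcount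
    obtain ⟨j', wh, hj', hlen, hperm⟩ := perm_replicate_append_horizontal w
    have hj0 : j' = 0 := by rw [hj', hcount0]
    subst hj0
    simp only [List.replicate_zero, List.nil_append, zero_add] at hperm hlen
    have hK : ContDiffOn ℝ (w.length : WithTop ℕ∞) (fun x => f c (Fin.append v x)) {x : Fin (m + 1) → ℝ | (Fin.append v x :) ∈ V0} :=
      (hfCk c).of_le (by exact_mod_cast hwlen)
    rw [pderivWord_perm hV0open hperm hK hx]
    have hK' : ContDiffOn ℝ (wh.length : WithTop ℕ∞) (fun x => f c (Fin.append v x)) {x : Fin (m + 1) → ℝ | (Fin.append v x :) ∈ V0} :=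
      (hfCk c).of_le (by exact_mod_cast (show wh.length ≤ k by omega))
    rw [pderivWord_map_castSucc_eq_section hV0open wh hK' hx]
    -- the section is `C^k` with bounded derivatives on the open `t`-fibre of `U_v`
    set t := x (Fin.last m) with ht
    have hfib : IsOpen {y : Fin m → ℝ | (Fin.append v (Fin.snoc y t) :) ∈ U} := by
      refine (hUopen v).preimage (continuous_pi fun l' => ?_)
      refine Fin.lastCases ?_ (fun j => ?_) l'
      · simp only [Fin.snoc_last]; exact continuous_const
      · simp only [Fin.snoc_castSucc]; exact continuous_apply j
    have hmem : Fin.init x ∈ {y : Fin m → ℝ | (Fin.append v (Fin.snoc y t) :) ∈ U} := by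
      show (Fin.append v (Fin.snoc (Fin.init x) (x (Fin.last m))) :) ∈ U
      rw [Fin.snoc_init_self]; exact hV0U hx
    have h := abs_pderivWord_le hfib wh ((hsecCk c v t).of_le (by exact_mod_cast (show wh.length ≤ k by omega))) hmem
    exact (h.trans (hsecbd c v t _ hmem wh.length (by omega))).trans (le_max_left _ _)

end C64Step


end Literature.ModelTheory.ExponentialFields

end
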